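import Summits.QuantumFields.BalabanUV.Beta.CompositeVertexWardRooted
import Summits.QuantumFields.BalabanUV.Beta.CompositeStencilWardReduction

/-!
# `BalabanUV.Beta.CompositeVertexWardRootedPacked` — row D1 ∕ (C1), PART 105b: THE ROOTED COMPOSITE V-TABLE OBEYS PART 104's BORDER LAW AGAINST `bhKcomp`,
# HENCE (S)_j HOLDS BY NAME FOR THE ROOTED COMPOSITE TABLES (presentation (ᴿ))

HONEST DEPENDENCY (page 1, mandatory): continuum YM on T⁴ ⇐ BetaPertH ∧ nine spine estimates (0/9 proved); BetaPertH ⇐ (D1) ∧ (D4) ∧ CAP+tail;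
G-an2-4 gates asym, D1 and NE2/3/4.  HONEST FRAMING (cell contract, verbatim): «discharging `BetaPertH` makes Bałaban's UV stability UNCONDITIONAL —
a real constructive-QFT result; it is NOT the continuum limit and NOT the Clay problem.»  ABSOLUTE RULE (cell charter, verbatim): «No internally-minted
statement may enter as a cited fact. Every hypothesis is either kernel-proved in this package or a verbatim quotation of a PUBLISHED theorem with page
reference. The manuscript(s) under audit are NOT citable for their own disputed steps — they are the thing under adjudication; programme-internal
(2001/route/tribunal) claims are never citable.»

WHY (row-D1 owner an2 gen 86, FINDING AN2-86-1).  PART 104 `CompositeStencilWardReduction.hSd_S0NOf_bhKcomp_iff_borderLaw`: the `hW𝒯 j` END's stencil letter (S)_j at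
`M := bhKcomp rc L m` holds iff the V-table obeys ONE border law against the ROOTED-PLAIN composite rows `compLinAvgAt rc L m`.  PART 105a
`CompositeVertexWardRooted.compVHKer_div_right_rooted`: the kernel-level Ward law of an2's top-peeled composite vertex kernel over an1's rooted bricks, composed root
`R m = Σ_{k<m} L^k • toSite (rc k)`.  This file packs it (`compVhS = packVH (compVHKer …) (L^m)`; §1), bridges the corrector's Form-level composite rows to the kernel-level composite
linear kernel (**`compLinAvgAt rc L m δ_f = (L^{d+1})^m · compLinKer (linKerAt ∘ rc) L m f`**, §2, induction through GAN24's bond-count expansion), and concludes: **the ROOTED composite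
V-table `compVhS (linKerAt ∘ rc) (vhKerAt ∘ rc) L m` obeys PART 104's border law at the lock `cH·cVH = −ξ·(L^{d+1})^m` with the diagonal generator rooted at the COMPOSED ROOT `R m`**
(§3 `borderLaw_compVhS_rooted`, POINTWISE in the varied site), hence **(S)_j HOLDS BY NAME for the slotted native spine over the rooted composite V-table and ANY every-rate-localised
Hessian table** (§3 `hSd_S0NOf_compVhS_rooted`) — presentation (ᴿ)'s (S)-letter of the `hW𝒯 j` END at the depth-`m` pins `cH·cE·½ = ξ`, `2·cVH = −(L^{d+1})^m·cE` (ADD2 §C3).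
The RECORD's sym table `compV` is NOT touched: its own rows are the sym composite rows, not `bhKcomp`'s (PREDICTION-AN2-86a).

WHAT: [folklore] packing + one induction + entrywise bookkeeping BY NAME; no `def`, no `def … : Prop`, nothing cited, 0 sorry.  Nothing of Bałaban's asserted, valued or discharged;
0 estimates; 0∕4 row-D1 binders; (W)_j NOT claimed; NOT (C1), NOT D1, NEVER «G-an2-4 closed», NOT BetaPertH, NOT continuum, NOT Clay.
Row D1 ∕ (C1) OWNER «beta-an2», gen 86, 2026-08-30.  No existing file touched.
-/

noncomputable section

open Finset
open scoped BigOperators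
open Literature.Probability.LatticeModels (Torus.proj)
open Literature.MathematicalPhysics.QuantumFieldTheory
open Literature.MathematicalPhysics.QuantumFieldTheory.Balaban1983to89
open Literature.MathematicalPhysics.QuantumFieldTheory.Balaban1983to89.Beta
open ExpKernelCalculus (MKer VertexFamily)
open OneStepResolventKernel (Fib)
open KernelWard (divV)
open AffineAveraging (Site box toSite unitVec)
open AveragingContours (off blk)
open AveragingHessianKernels (Bond Near packVH packVH_inl_inr packVH_inr_inl packVH_inl_inl packVH_inr_inr eq_smul_blk_of_off_eq_zero)
open AveragingHessianKernelsRooted (linKerAt vhKerAt linCountAt)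
open AveragingContoursRooted (linAvgAt)
open AveragingWardStencils (b6UnitVec_eq)
open KKTFluctuationKernel (delta1 delta1_apply)
open LatticeForm (quo)
open Summit.QuantumFields.BalabanUV.Beta.ChartConjugation (conjV)
open Summit.QuantumFields.BalabanUV.Beta.BorderedHessian (diagK off_eq_zero_iff_proj blk_eq_quo)
open Summit.QuantumFields.BalabanUV.Beta.AveragingWardRootedStencils (legInd)
open Summit.QuantumFields.BalabanUV.Beta.WardLocusStencils (ffK)
open Summit.QuantumFields.BalabanUV.Beta.SpineRooted (S0NOf)
open Summit.QuantumFields.BalabanUV.Beta.LinearGaugeVH (nearBox mem_nearBox)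
open Summit.QuantumFields.BalabanUV.Beta.GAN24.ContactLambdaCommutator (linAvgAt_eq_sum_linCountAt)
open Summit.QuantumFields.BalabanUV.Beta.CompositeAveragingCoarseExact (compLinAvgAt compLinAvgAt_zero compLinAvgAt_succ)
open Summit.QuantumFields.BalabanUV.Beta.RelInvComposite (bhKcomp)
open Summit.QuantumFields.BalabanUV.Beta.CompositeVertexKernelRec
open Summit.QuantumFields.BalabanUV.Beta.CompositeVertexWardRooted (sum_offs_eq_sum_nearBox compVHKer_div_right_rooted)
open Summit.QuantumFields.BalabanUV.Beta.CompositeStencilWardReduction (conjV_border_bhKcomp_legInd_inl_inr conjV_border_bhKcomp_legInd_inr_inl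
  conjV_border_bhKcomp_legInd_inl_inl conjV_border_bhKcomp_legInd_inr_inr hSd_S0NOf_bhKcomp_of_borderLaw)

namespace Summit.QuantumFields.BalabanUV.Beta.CompositeVertexWardRootedPacked

variable {d : ℕ} {L : ℕ} {r : ℕ → Fin (d + 1) → ℕ}

/-! ## §1 The packed rooted composite V-table's divergence, entrywise -/

section Packed

/-- [folklore] **`(inl, inr)` BLOCK**: for the fluctuation leg `(α, x)` and the multiplier leg `(μ, z)` at a coarse image `z` of blocking `L^m`,
`divV (compVhS …) u ((x, inl α), (z, inr μ)) = [off z = 0]·([z + R m = u] − [x = u]) · compLinKer m (α, x) (μ, blk z)` — the composed root of the multiplier leg is `z + R m`. -/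
theorem divV_compVhS_rooted_inl_inr (hL : 1 ≤ L) (hr : ∀ k, r k ∈ box (d + 1) L) (m : ℕ) (u x z : Site (d + 1)) (α μ : Fin (d + 1)) :
    divV (compVhS (fun k => linKerAt (toSite (r k)) L) (fun k => vhKerAt (toSite (r k)) L) L m) u x z (Sum.inl α) (Sum.inr μ) =
      if off (L ^ m) z = 0 then
        ((if z + ∑ k ∈ Finset.range m, ((L ^ k : ℕ) : ℤ) • toSite (r k) = u then (1 : ℝ) else 0) - (if x = u then (1 : ℝ) else 0)) *
          compLinKer (fun k => linKerAt (toSite (r k)) L) L m (α, x) (μ, blk (L ^ m) z)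
      else 0 := by
  simp only [KernelWard.divV, Finset.sum_apply, Pi.sub_apply, compVhS, packVH_inl_inr]
  by_cases hz : off (L ^ m) z = 0
  · simp only [hz, if_true, b6UnitVec_eq]
    rw [compVHKer_div_right_rooted hL hr m μ (blk (L ^ m) z) (α, x) u,
      ← eq_smul_blk_of_off_eq_zero (Nat.one_le_pow m L hL) hz]
  · simp [hz]

/-- [folklore] **`(inr, inl)` BLOCK** (the packer's symmetric twin, legs exchanged):
`divV (compVhS …) u ((x, inr μ), (z, inl α)) = [off x = 0]·([x + R m = u] − [z = u]) · compLinKer m (α, z) (μ, blk x)`. -/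
theorem divV_compVhS_rooted_inr_inl (hL : 1 ≤ L) (hr : ∀ k, r k ∈ box (d + 1) L) (m : ℕ) (u x z : Site (d + 1)) (μ α : Fin (d + 1)) :
    divV (compVhS (fun k => linKerAt (toSite (r k)) L) (fun k => vhKerAt (toSite (r k)) L) L m) u x z (Sum.inr μ) (Sum.inl α) =
      if off (L ^ m) x = 0 then
        ((if x + ∑ k ∈ Finset.range m, ((L ^ k : ℕ) : ℤ) • toSite (r k) = u then (1 : ℝ) else 0) - (if z = u then (1 : ℝ) else 0)) *
          compLinKer (fun k => linKerAt (toSite (r k)) L) L m (α, z) (μ, blk (L ^ m) x)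
      else 0 := by
  simp only [KernelWard.divV, Finset.sum_apply, Pi.sub_apply, compVhS, packVH_inr_inl]
  by_cases hx : off (L ^ m) x = 0
  · simp only [hx, if_true, b6UnitVec_eq]
    rw [compVHKer_div_right_rooted hL hr m μ (blk (L ^ m) x) (α, z) u,
      ← eq_smul_blk_of_off_eq_zero (Nat.one_le_pow m L hL) hx]
  · simp [hx]

/-- [folklore] The divergence vanishes on the field–field block (so does the packed table). -/
theorem divV_compVhS_inl_inl (ℓ : ℕ → Fin (d + 1) → Site (d + 1) → Bond (d + 1) → ℝ)
    (𝓋 : ℕ → Fin (d + 1) → Site (d + 1) → Bond (d + 1) → Bond (d + 1) → ℝ) (L m : ℕ) (u x z : Site (d + 1)) (α α' : Fin (d + 1)) :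
    divV (compVhS ℓ 𝓋 L m) u x z (Sum.inl α) (Sum.inl α') = 0 := by
  simp [KernelWard.divV, Finset.sum_apply, compVhS]

/-- [folklore] The divergence vanishes on the multiplier–multiplier block. -/
theorem divV_compVhS_inr_inr (ℓ : ℕ → Fin (d + 1) → Site (d + 1) → Bond (d + 1) → ℝ)
    (𝓋 : ℕ → Fin (d + 1) → Site (d + 1) → Bond (d + 1) → Bond (d + 1) → ℝ) (L m : ℕ) (u x z : Site (d + 1)) (μ μ' : Fin (d + 1)) :
    divV (compVhS ℓ 𝓋 L m) u x z (Sum.inr μ) (Sum.inr μ') = 0 := by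
  simp [KernelWard.divV, Finset.sum_apply, compVhS]

end Packed

/-! ## §2 The corrector's composite rows ARE the composite linear kernel over an1's rooted bricks (Form level ↔ kernel level) -/

section Bridge

/-- [folklore] **`compLinAvgAt rc L m δ_f = (L^{d+1})^m · compLinKer (linKerAt ∘ rc) L m f`** — the ROOTED-PLAIN composite rows of `bhKcomp`'s border (`CompositeCorrectorBordered`)
are, bond by bond, an2's top-peeled composite linear kernel over an1's rooted single-comb-order bricks, in an1's normalisation (induction on `m`: `compLinAvgAt_succ`, GAN24's
bond-count expansion `linAvgAt_eq_sum_linCountAt`, `q¹ = count ∕ L^{d+1}`, the window as `nearBox`, `compLinKer_succ`). -/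
theorem compLinAvgAt_delta1_eq_pow_mul_compLinKer (hL : 1 ≤ L) (hr : ∀ k, r k ∈ box (d + 1) L) :
    ∀ (m : ℕ) (f : Bond (d + 1)) (κ : Fin (d + 1)) (Y : Site (d + 1)),
      compLinAvgAt r L m (delta1 f.1 f.2) κ Y = (((L : ℝ) ^ (d + 1)) ^ m) * compLinKer (fun k => linKerAt (toSite (r k)) L) L m f (κ, Y)
  | 0, f, κ, Y => by
    rw [compLinAvgAt_zero, compLinKer_zero, pow_zero, one_mul, delta1_apply]
    have e : (κ = f.1 ∧ Y = f.2) ↔ ((κ, Y) : Bond (d + 1)) = f :=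
      ⟨fun ⟨h1, h2⟩ => Prod.ext h1 h2, fun h => ⟨congrArg Prod.fst h, congrArg Prod.snd h⟩⟩
    rw [if_congr e rfl rfl]
  | m + 1, f, κ, Y => by
    have hL' : (L : ℝ) ^ (d + 1) ≠ 0 := pow_ne_zero _ (by exact_mod_cast (show L ≠ 0 by omega))
    rw [compLinAvgAt_succ, linAvgAt_eq_sum_linCountAt (hr m) _ κ Y, compLinKer_succ,
      ← sum_offs_eq_sum_nearBox Y (fun x => ∑ α : Fin (d + 1), (linCountAt (toSite (r m)) L κ Y (α, x) : ℝ) * compLinAvgAt r L m (delta1 f.1 f.2) α x),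
      Finset.sum_comm, Finset.mul_sum]
    dsimp only
    refine Finset.sum_congr rfl fun α _ => ?_
    rw [Finset.mul_sum]
    refine Finset.sum_congr rfl fun e _ => ?_
    rw [compLinAvgAt_delta1_eq_pow_mul_compLinKer hL hr m f α ((L : ℤ) • Y + e), linKerAt]
    field_simp
    ring

end Bridge

/-! ## §3 PART 104's border law for the rooted composite V-table, and (S) by name for presentation (ᴿ) -/

section BorderLaw

/-- [folklore] **THE ROOTED COMPOSITE V-TABLE OBEYS PART 104's BORDER LAW AGAINST `bhKcomp`, POINTWISE IN THE VARIED SITE** (in-block roots, `1 ≤ L`; lock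
`cH·cVH = −ξ·(L^{d+1})^m`; diagonal generator rooted at the composed root `R m = Σ_{k<m} L^k • toSite (rc k)`):
`(cH·cVH) • divV (compVhS (linKerAt ∘ rc) (vhKerAt ∘ rc) L m) u = ξ • conjV (bhKcomp rc L m − ffK (bhKcomp rc L m)) (diagK (legInd (R m) u))`. -/
theorem borderLaw_compVhS_rooted (hL : 1 ≤ L) (hr : ∀ k, r k ∈ box (d + 1) L) (m : ℕ) [NeZero (L ^ m)] {cH cVH ξ : ℝ}
    (h₂ : cH * cVH = -(ξ * ((L : ℝ) ^ (d + 1)) ^ m)) (u : Site (d + 1)) :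
    (cH * cVH) • divV (compVhS (fun k => linKerAt (toSite (r k)) L) (fun k => vhKerAt (toSite (r k)) L) L m) u =
      ξ • conjV (bhKcomp r L m - ffK (bhKcomp r L m)) (diagK (legInd (∑ k ∈ Finset.range m, ((L ^ k : ℕ) : ℤ) • toSite (r k)) u)) := by
  have hL0 : 0 < L := hL
  funext x z a b
  rw [Pi.smul_apply, Pi.smul_apply, Pi.smul_apply, Pi.smul_apply, smul_eq_mul, Pi.smul_apply, Pi.smul_apply, Pi.smul_apply, Pi.smul_apply,
    smul_eq_mul]
  rcases a with α | μ <;> rcases b with α' | μ'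
  · rw [divV_compVhS_inl_inl, conjV_border_bhKcomp_legInd_inl_inl r m, mul_zero, mul_zero]
  · rw [divV_compVhS_rooted_inl_inr hL hr m u x z α μ', conjV_border_bhKcomp_legInd_inl_inr r hL0 m]
    by_cases hz : off (L ^ m) z = 0
    · rw [if_pos hz, if_pos ((off_eq_zero_iff_proj z).1 hz), ← blk_eq_quo, compLinAvgAt_delta1_eq_pow_mul_compLinKer hL hr m (α, x) μ' (blk (L ^ m) z), h₂]
      ring
    · rw [if_neg hz, if_neg (fun h => hz ((off_eq_zero_iff_proj z).2 h)), mul_zero, zero_mul, mul_zero]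
  · rw [divV_compVhS_rooted_inr_inl hL hr m u x z μ α', conjV_border_bhKcomp_legInd_inr_inl r hL0 m]
    by_cases hx : off (L ^ m) x = 0
    · rw [if_pos hx, if_pos ((off_eq_zero_iff_proj x).1 hx), ← blk_eq_quo, compLinAvgAt_delta1_eq_pow_mul_compLinKer hL hr m (α', z) μ (blk (L ^ m) x), h₂]
      ring
    · rw [if_neg hx, if_neg (fun h => hx ((off_eq_zero_iff_proj x).2 h)), mul_zero, zero_mul, mul_zero]
  · rw [divV_compVhS_inr_inr, conjV_border_bhKcomp_legInd_inr_inr r m, mul_zero, mul_zero]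

/-- [folklore] The same, block-summed (the shape PART 104 consumes). -/
theorem borderLaw_compVhS_rooted_blockSum (hL : 1 ≤ L) (hr : ∀ k, r k ∈ box (d + 1) L) (m : ℕ) [NeZero (L ^ m)] {cH cVH ξ : ℝ}
    (h₂ : cH * cVH = -(ξ * ((L : ℝ) ^ (d + 1)) ^ m)) (y : Site (d + 1)) :
    (cH * cVH) • ∑ v ∈ box (d + 1) (L ^ m), divV (compVhS (fun k => linKerAt (toSite (r k)) L) (fun k => vhKerAt (toSite (r k)) L) L m) (((L ^ m : ℕ) : ℤ) • y + toSite v) =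
      ξ • ∑ v ∈ box (d + 1) (L ^ m), conjV (bhKcomp r L m - ffK (bhKcomp r L m))
        (diagK (legInd (∑ k ∈ Finset.range m, ((L ^ k : ℕ) : ℤ) • toSite (r k)) (((L ^ m : ℕ) : ℤ) • y + toSite v))) := by
  rw [Finset.smul_sum, Finset.smul_sum]
  exact Finset.sum_congr rfl fun v _ => borderLaw_compVhS_rooted hL hr m h₂ _

/-- [folklore] **(S)_j BY NAME FOR PRESENTATION (ᴿ)**: the slotted native spine over the ROOTED composite V-table `compVhS (linKerAt ∘ rc) (vhKerAt ∘ rc) L m` and ANY Hessian table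
localised at every rate satisfies the `hW𝒯 j` END's stencil Ward letter at `M := bhKcomp rc L m`, with the diagonal generator rooted at the composed root `R m`, on the depth-`m` pin
hyperplane `cH·cE·½ = ξ`, `cH·cVH = −ξ·(L^{d+1})^m` (PART 104 `hSd_S0NOf_bhKcomp_of_borderLaw` fed by §3). -/
theorem hSd_S0NOf_compVhS_rooted (hL : 1 ≤ L) (hr : ∀ k, r k ∈ box (d + 1) L) (m : ℕ) [NeZero (L ^ m)]
    (H : Fin (d + 1) → (Fin (d + 1) → ℤ) → MKer (d + 1) (Fib d)) (hH : ∀ δ : ℝ, 0 ≤ δ → ∃ C : ℝ, VertexFamily H (L ^ m) C δ)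
    {cE cVH cH ξ : ℝ} (cΛ : ℝ) (h₁ : cH * cE * (1 / 2) = ξ) (h₂ : cH * cVH = -(ξ * ((L : ℝ) ^ (d + 1)) ^ m)) (y : Site (d + 1)) :
    cH • ∑ v ∈ box (d + 1) (L ^ m), divV (S0NOf d (L ^ m) (compVhS (fun k => linKerAt (toSite (r k)) L) (fun k => vhKerAt (toSite (r k)) L) L m) H cE cVH cΛ)
        (((L ^ m : ℕ) : ℤ) • y + toSite v) =
      conjV (bhKcomp r L m) (diagK (ξ • ∑ v ∈ box (d + 1) (L ^ m),
        legInd (∑ k ∈ Finset.range m, ((L ^ k : ℕ) : ℤ) • toSite (r k)) (((L ^ m : ℕ) : ℤ) • y + toSite v))) :=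
  hSd_S0NOf_bhKcomp_of_borderLaw r hL m _ H hH _ cVH cΛ h₁ (fun y' => borderLaw_compVhS_rooted_blockSum hL hr m h₂ y') y

end BorderLaw

end Summit.QuantumFields.BalabanUV.Beta.CompositeVertexWardRootedPacked

end
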